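import Summits.KontsevichZagierPeriods.KontsevichZagierPeriods.Theses.AttractorUnfolding
import Summits.KontsevichZagierPeriods.KontsevichZagierPeriods.Theorems.MzvKernelInKZ.Negative.ScalingDivision
import Literature.NumberTheory.Transcendental.KZUnfolding

/-!
# Crux `FibrewiseResidue` (stmt-KontsevichZagierPeriods-11361) — skeleton line `pole_swap`

Route: route-KontsevichZagierPeriods-AttractorUnfolding (E2, the 2πi-carrier; crux strategist r1).

The crux: over a ℚ-semialgebraic base `τ`, `[τ × ℝ, Re(a(x)·w′(t)/(w(t) − p(x)))]` (Cayley
parametrisation `w = c + s(1+it)/(1−it)` of the fibre circle `|w − c(x)| = s(x)`, pole `p(x)` INSIDE)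
is KZ-equivalent to the arctangent carrier `[τ × ℝ, −2·Im a(x)/(1+t²)]`.

Mechanism (`pole_swap`). In the Cayley parameter `t` the kernel has EXACT partial fractions
`a·w′/(w − p) = a/(t − t₂(x)) − a/(t + i)`, `t₂ = i(s+q)/(s−q)`, `q = c − p`, with
`α = Re t₂ = −2sq₂/|s−q|²`, `β = Im t₂ = (s² − |q|²)/|s−q|² > 0` (rational in the data); hence
`Re(a·w′/(w−p)) − (−2 Im a/(1+t²)) = h(x,t) := Re a·(g_(α,β) − g_(0,1)) − Im a·(P_(α,β) − P_(0,1))`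
with `g_(α,β)(t) = (t−α)/((t−α)²+β²)` and the Poisson kernel `P_(α,β)(t) = β/((t−α)²+β²)` — the
difference of the SAME real kernel at the two upper-half-plane points `t₂(x)` and `i`
(`stub_cayleyDifference`, one instance of move (1b)). The unique real Möbius INVOLUTION exchanging
`i` and `t₂(x)`, `M_x(t) = (αt − β(1+β) − α²)/((1+β)t − α)` (`det = β(α² + (1+β)²) > 0`, so
orientation-preserving on each of its two branches), satisfies `h(x, M_x t)·M_x′(t) = −h(x,t)`:
ONE fibrewise instance of move (2) (on the `C¹` cells of `α, β`; the pole graph `t = α/(1+β)` and the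
lower-dimensional cells are null) gives `[τ × ℝ, h] ∼ [τ × ℝ, −h]` (`stub_swapInvolution`). With
`[H] + [H.neg] ∈ relations` (move (1b), `KZ.of_add_of_neg_mem_levelRel`) this is `2·[H] ∈ relations`,
and INTEGER DIVISION IS A DERIVED RULE (`MzvKernelInKZ.Negative.mem_relations_of_nsmul_mem`, in tree),
so `[H] ∈ relations` and `[r] − [r'] = ([r] − [r'] − [H]) + [H] ∈ relations` — the composition
`FibrewiseResidue_of_stubs`, kernel-checked below. No logarithm, no arctangent, no winding-number
bookkeeping, no double cover: the residue theorem with parameters is the 2-torsion identity of the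
hyperbolic half-turn about the midpoint of `i` and `t₂(x)`.
-/

set_option linter.dupNamespace false

namespace Summit.KontsevichZagierPeriods.KontsevichZagierPeriods.Cruxes.FibrewiseResidue.PoleSwap

open Set

/-- CAYLEY DIFFERENCE (partial fractions + one instance of move (1b)): for the crux data there are
ℚ-semialgebraic `α, β` on `τ` with `β > 0` (intended witnesses: `α = −2·s·q₂/((s−q₁)²+q₂²)`,
`β = (s² − q₁² − q₂²)/((s−q₁)²+q₂²)`, `q = c − p = q₁ + iq₂`, i.e. `α + iβ = i(s+q)/(s−q)`, the
second root in `t` of the Cayley denominator) and an integral representation `H` over `τ × ℝ` with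
integrand `h = Re a·((t−α)/((t−α)²+β²) − t/(1+t²)) − Im a·(β/((t−α)²+β²) − 1/(1+t²))` such that
`[r] − [r'] − [H]` is a relation (`r.integrand = r'.integrand + h` pointwise on the domain, by the
partial-fraction identity `a·w′/(w−p) = a/(t − α − iβ) − a/(t + i)`; `H` is integrable as a difference
of integrable functions and semialgebraic by the toolkit). Size M. -/
theorem stub_cayleyDifference :
    ∀ (n : ℕ) (τ : Set (Fin n → ℝ)) (c p a : (Fin n → ℝ) → ℂ) (s : (Fin n → ℝ) → ℝ) (r r' : Literature.NumberTheory.Transcendental.KZ.IntegralRep (n + 1)), Literature.ModelTheory.ExponentialFields.IsSemialgebraic ℚ τ → Literature.NumberTheory.Transcendental.IsSemialgebraicFunOn ℚ τ (fun x => (c x).re) → Literature.NumberTheory.Transcendental.IsSemialgebraicFunOn ℚ τ (fun x => (c x).im) → Literature.NumberTheory.Transcendental.IsSemialgebraicFunOn ℚ τ (fun x => (p x).re) → Literature.NumberTheory.Transcendental.IsSemialgebraicFunOn ℚ τ (fun x => (p x).im) → Literature.NumberTheory.Transcendental.IsSemialgebraicFunOn ℚ τ (fun x => (a x).re) → Literature.NumberTheory.Transcendental.IsSemialgebraicFunOn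 ℚ τ (fun x => (a x).im) → Literature.NumberTheory.Transcendental.IsSemialgebraicFunOn ℚ τ s → (∀ x ∈ τ, ‖p x - c x‖ < s x) → r.domain = {z | (Fin.init z : Fin n → ℝ) ∈ τ} → r'.domain = {z | (Fin.init z : Fin n → ℝ) ∈ τ} → Set.EqOn r.integrand (fun z => (a (Fin.init z) * (2 * Complex.I * (s (Fin.init z) : ℂ) / (1 - (z (Fin.last n) : ℂ) * Complex.I) ^ 2) / ((c (Fin.init z) + (s (Fin.init z) : ℂ) * (1 + (z (Fin.last n) : ℂ) * Complex.I) / (1 - (z (Fin.last n) : ℂ) * Complex.I)) - p (Fin.init z))).re) r.domain → Set.EqOn r'.integrand (fun z => -2 * (a (Fin.init z)).im / (1 + z (Fin.last n) ^ 2)) r'.domain → ∃ (α β : (Fin n → ℝ) → ℝ) (H : Literature.NumberTheory.Transcendental.KZ.IntegralRep (n + 1)), Literature.NumberTheory.Transcendental.IsSemialgebraicFunOn ℚ τ α ∧ Literature.NumberTheory.Transcendental.IsSemialgebraicFunOn ℚ τ β ∧ (∀ x ∈ τ, 0 < β x) ∧ H.domain = {z | (Fin.init z : Fin n → ℝ)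 ∈ τ} ∧ Set.EqOn H.integrand (fun z => (a (Fin.init z)).re * ((z (Fin.last n) - α (Fin.init z)) / ((z (Fin.last n) - α (Fin.init z)) ^ 2 + β (Fin.init z) ^ 2) - z (Fin.last n) / (1 + z (Fin.last n) ^ 2)) - (a (Fin.init z)).im * (β (Fin.init z) / ((z (Fin.last n) - α (Fin.init z)) ^ 2 + β (Fin.init z) ^ 2) - 1 / (1 + z (Fin.last n) ^ 2))) H.domain ∧ Literature.NumberTheory.Transcendental.KZ.of r - Literature.NumberTheory.Transcendental.KZ.of r' - Literature.NumberTheory.Transcendental.KZ.of H ∈ Literature.NumberTheory.Transcendental.KZ.relations := by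
  sorry

/-- SWAP INVOLUTION (one fibrewise instance of move (2)): for ℚ-semialgebraic `κ₁ κ₂ α β` on a
ℚ-semialgebraic `τ` with `β > 0`, the representation over `τ × ℝ` with integrand
`h = κ₁·((t−α)/((t−α)²+β²) − t/(1+t²)) − κ₂·(β/((t−α)²+β²) − 1/(1+t²))` is KZ-equivalent to the one
with integrand `−h`: the real Möbius involution `M_x(t) = (α t − β(1+β) − α²)/((1+β) t − α)` exchanges
the poles `i` and `α + iβ`, has `M′ > 0` on both branches (`det = β(α² + (1+β)²)`), maps
`ℝ ∖ {α/(1+β)}` onto itself, and pulls `h dt` back to `−h dt`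
(`d log(M(u) − w) = du/(u − M(w)) − du/(u − M(∞))`, the `M(∞)`-terms cancelling in the differences);
apply move (2) with `Φ(x,t) = (x, M_x t)` on `C × (ℝ ∖ pole)` for the open `C¹` cells `C` of a
cell decomposition of `τ` adapted to `α, β` (`exists_c1CAD_c1On`), the remaining cells and the pole
graph being Lebesgue-null (move (1a)). Size M/L; no transcendence input, no value hypothesis. -/
theorem stub_swapInvolution :
    ∀ (n : ℕ) (τ : Set (Fin n → ℝ)) (κ₁ κ₂ α β : (Fin n → ℝ) → ℝ) (H H' : Literature.NumberTheory.Transcendental.KZ.IntegralRep (n + 1)), Literature.ModelTheory.ExponentialFields.IsSemialgebraic ℚ τ → Literature.NumberTheory.Transcendental.IsSemialgebraicFunOn ℚ τ κ₁ → Literature.NumberTheory.Transcendental.IsSemialgebraicFunOn ℚ τ κ₂ → Literature.NumberTheory.Transcendental.IsSemialgebraicFunOn ℚ τ α → Literature.NumberTheory.Transcendental.IsSemialgebraicFunOn ℚ τ β → (∀ x ∈ τ, 0 < β x) → H.domain = {z | (Fin.init z : Fin n → ℝ) ∈ τ} → H'.domain = {z | (Fin.init z : Fin n → ℝ) ∈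 τ} → Set.EqOn H.integrand (fun z => κ₁ (Fin.init z) * ((z (Fin.last n) - α (Fin.init z)) / ((z (Fin.last n) - α (Fin.init z)) ^ 2 + β (Fin.init z) ^ 2) - z (Fin.last n) / (1 + z (Fin.last n) ^ 2)) - κ₂ (Fin.init z) * (β (Fin.init z) / ((z (Fin.last n) - α (Fin.init z)) ^ 2 + β (Fin.init z) ^ 2) - 1 / (1 + z (Fin.last n) ^ 2))) H.domain → Set.EqOn H'.integrand (fun z => -(κ₁ (Fin.init z) * ((z (Fin.last n) - α (Fin.init z)) / ((z (Fin.last n) - α (Fin.init z)) ^ 2 + β (Fin.init z) ^ 2) - z (Fin.last n) / (1 + z (Fin.last n) ^ 2)) - κ₂ (Fin.init z) * (β (Fin.init z) / ((z (Fin.last n) - α (Fin.init z)) ^ 2 + β (Fin.init z) ^ 2) - 1 / (1 + z (Fin.last n) ^ 2)))) H'.domain → Literature.NumberTheory.Transcendental.KZ.Equivalent H H' := by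
  sorry

/-- ASSEMBLY, arrow form (kernel-checked, no `sorry`): the two stub statements imply the crux
statement (conclusion = the crux signature UNFOLDED verbatim). Proof: `stub_cayleyDifference` gives
`α, β, H` with `[r] − [r'] − [H] ∈ relations`; `stub_swapInvolution` with `κ₁ = Re a`, `κ₂ = Im a`,
`H' = H.neg` gives `[H] − [H.neg] ∈ relations`; `[H] + [H.neg] ∈ relations`
(`KZ.of_add_of_neg_mem_levelRel`); so `2 • [H] ∈ relations`, hence `[H] ∈ relations` by integer
division (`MzvKernelInKZ.Negative.mem_relations_of_nsmul_mem`), and `[r] − [r']` is the sum of two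
relations. -/
theorem FibrewiseResidue_of_stubs :
    (∀ (n : ℕ) (τ : Set (Fin n → ℝ)) (c p a : (Fin n → ℝ) → ℂ) (s : (Fin n → ℝ) → ℝ) (r r' : Literature.NumberTheory.Transcendental.KZ.IntegralRep (n + 1)), Literature.ModelTheory.ExponentialFields.IsSemialgebraic ℚ τ → Literature.NumberTheory.Transcendental.IsSemialgebraicFunOn ℚ τ (fun x => (c x).re) → Literature.NumberTheory.Transcendental.IsSemialgebraicFunOn ℚ τ (fun x => (c x).im) → Literature.NumberTheory.Transcendental.IsSemialgebraicFunOn ℚ τ (fun x => (p x).re) → Literature.NumberTheory.Transcendental.IsSemialgebraicFunOn ℚ τ (fun x => (p x).im) → Literature.NumberTheory.Transcendental.IsSemialgebraicFunOn ℚ τ (fun x => (a x).re) → Literature.NumberTheory.Transcendental.IsSemialgebraicFunOn ℚ τ (fun x => (a x).im) → Literature.NumberTheory.Transcendental.IsSemialgebraicFunOn ℚ τ s → (∀ x ∈ τ, ‖p x - c x‖ < s x) → r.domain = {z | (Fin.init z : Fin n → ℝ) ∈ τ} → r'.domain = {z | (Fin.init z : Fin n → ℝ) ∈ τ} → Set.EqOn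 r.integrand (fun z => (a (Fin.init z) * (2 * Complex.I * (s (Fin.init z) : ℂ) / (1 - (z (Fin.last n) : ℂ) * Complex.I) ^ 2) / ((c (Fin.init z) + (s (Fin.init z) : ℂ) * (1 + (z (Fin.last n) : ℂ) * Complex.I) / (1 - (z (Fin.last n) : ℂ) * Complex.I)) - p (Fin.init z))).re) r.domain → Set.EqOn r'.integrand (fun z => -2 * (a (Fin.init z)).im / (1 + z (Fin.last n) ^ 2)) r'.domain → ∃ (α β : (Fin n → ℝ) → ℝ) (H : Literature.NumberTheory.Transcendental.KZ.IntegralRep (n + 1)), Literature.NumberTheory.Transcendental.IsSemialgebraicFunOn ℚ τ α ∧ Literature.NumberTheory.Transcendental.IsSemialgebraicFunOn ℚ τ β ∧ (∀ x ∈ τ, 0 < β x) ∧ H.domain = {z | (Fin.init z : Fin n → ℝ) ∈ τ} ∧ Set.EqOn H.integrand (fun z => (a (Fin.init z)).re * ((z (Fin.last n) - α (Fin.init z)) / ((z (Fin.last n) - α (Fin.init z)) ^ 2 + β (Fin.init z) ^ 2) - z (Fin.last n) / (1 + z (Fin.last n) ^ 2)) - (a (Fin.init z)).im * (β (Fin.init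 z) / ((z (Fin.last n) - α (Fin.init z)) ^ 2 + β (Fin.init z) ^ 2) - 1 / (1 + z (Fin.last n) ^ 2))) H.domain ∧ Literature.NumberTheory.Transcendental.KZ.of r - Literature.NumberTheory.Transcendental.KZ.of r' - Literature.NumberTheory.Transcendental.KZ.of H ∈ Literature.NumberTheory.Transcendental.KZ.relations) →
    (∀ (n : ℕ) (τ : Set (Fin n → ℝ)) (κ₁ κ₂ α β : (Fin n → ℝ) → ℝ) (H H' : Literature.NumberTheory.Transcendental.KZ.IntegralRep (n + 1)), Literature.ModelTheory.ExponentialFields.IsSemialgebraic ℚ τ → Literature.NumberTheory.Transcendental.IsSemialgebraicFunOn ℚ τ κ₁ → Literature.NumberTheory.Transcendental.IsSemialgebraicFunOn ℚ τ κ₂ → Literature.NumberTheory.Transcendental.IsSemialgebraicFunOn ℚ τ α → Literature.NumberTheory.Transcendental.IsSemialgebraicFunOn ℚ τ β → (∀ x ∈ τ, 0 < β x) → H.domain = {z | (Fin.init z : Fin n → ℝ) ∈ τ} → H'.domain = {z | (Fin.init z : Fin n → ℝ) ∈ τ} → Set.EqOn H.integrand (fun z => κ₁ (Fin.init z) * ((z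 (Fin.last n) - α (Fin.init z)) / ((z (Fin.last n) - α (Fin.init z)) ^ 2 + β (Fin.init z) ^ 2) - z (Fin.last n) / (1 + z (Fin.last n) ^ 2)) - κ₂ (Fin.init z) * (β (Fin.init z) / ((z (Fin.last n) - α (Fin.init z)) ^ 2 + β (Fin.init z) ^ 2) - 1 / (1 + z (Fin.last n) ^ 2))) H.domain → Set.EqOn H'.integrand (fun z => -(κ₁ (Fin.init z) * ((z (Fin.last n) - α (Fin.init z)) / ((z (Fin.last n) - α (Fin.init z)) ^ 2 + β (Fin.init z) ^ 2) - z (Fin.last n) / (1 + z (Fin.last n) ^ 2)) - κ₂ (Fin.init z) * (β (Fin.init z) / ((z (Fin.last n) - α (Fin.init z)) ^ 2 + β (Fin.init z) ^ 2) - 1 / (1 + z (Fin.last n) ^ 2)))) H'.domain → Literature.NumberTheory.Transcendental.KZ.Equivalent H H') →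
    ∀ (n : ℕ) (τ : Set (Fin n → ℝ)) (c p a : (Fin n → ℝ) → ℂ) (s : (Fin n → ℝ) → ℝ) (r r' : Literature.NumberTheory.Transcendental.KZ.IntegralRep (n + 1)), Literature.ModelTheory.ExponentialFields.IsSemialgebraic ℚ τ → Literature.NumberTheory.Transcendental.IsSemialgebraicFunOn ℚ τ (fun x => (c x).re) → Literature.NumberTheory.Transcendental.IsSemialgebraicFunOn ℚ τ (fun x => (c x).im) → Literature.NumberTheory.Transcendental.IsSemialgebraicFunOn ℚ τ (fun x => (p x).re) → Literature.NumberTheory.Transcendental.IsSemialgebraicFunOn ℚ τ (fun x => (p x).im) → Literature.NumberTheory.Transcendental.IsSemialgebraicFunOn ℚ τ (fun x => (a x).re) → Literature.NumberTheory.Transcendental.IsSemialgebraicFunOn ℚ τ (fun x => (a x).im) → Literature.NumberTheory.Transcendental.IsSemialgebraicFunOn ℚ τ s → (∀ x ∈ τ, ‖p x - c x‖ < s x) → r.domain = {z | (Fin.init z : Fin n → ℝ) ∈ τ} → r'.domain = {z | (Fin.init z : Fin n → ℝ) ∈ τ} → Set.EqOn r.integrand (fun z => (a (Fin.init z) * (2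 * Complex.I * (s (Fin.init z) : ℂ) / (1 - (z (Fin.last n) : ℂ) * Complex.I) ^ 2) / ((c (Fin.init z) + (s (Fin.init z) : ℂ) * (1 + (z (Fin.last n) : ℂ) * Complex.I) / (1 - (z (Fin.last n) : ℂ) * Complex.I)) - p (Fin.init z))).re) r.domain → Set.EqOn r'.integrand (fun z => -2 * (a (Fin.init z)).im / (1 + z (Fin.last n) ^ 2)) r'.domain → Literature.NumberTheory.Transcendental.KZ.Equivalent r r' := by
  intro hCayley hSwap n τ c p a s r r' hτ hc1 hc2 hp1 hp2 ha1 ha2 hs hin hdom hdom' hint hint'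
  obtain ⟨α, β, H, hα, hβ, hβ0, hHdom, hHint, hsplit⟩ :=
    hCayley n τ c p a s r r' hτ hc1 hc2 hp1 hp2 ha1 ha2 hs hin hdom hdom' hint hint'
  -- the swapped copy is `H.neg`
  have hnegdom : H.neg.domain = {z | (Fin.init z : Fin n → ℝ) ∈ τ} := by
    rw [Literature.NumberTheory.Transcendental.KZ.IntegralRep.domain_neg, hHdom]
  have hnegint : Set.EqOn H.neg.integrand (fun z => -((a (Fin.init z)).re * ((z (Fin.last n) - α (Fin.init z)) / ((z (Fin.last n) - α (Fin.init z)) ^ 2 + β (Fin.init z) ^ 2) - z (Fin.last n) / (1 + z (Fin.last n) ^ 2)) - (a (Fin.init z)).im * (β (Fin.init z) / ((z (Fin.last n) - α (Fin.init z)) ^ 2 + β (Fin.init z) ^ 2) - 1 / (1 + z (Fin.last n) ^ 2)))) H.neg.domain := by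
    intro z hz
    rw [Literature.NumberTheory.Transcendental.KZ.IntegralRep.domain_neg] at hz
    rw [Literature.NumberTheory.Transcendental.KZ.IntegralRep.integrand_neg, Pi.neg_apply, hHint hz]
  have hswap : Literature.NumberTheory.Transcendental.KZ.Equivalent H H.neg :=
    hSwap n τ (fun x => (a x).re) (fun x => (a x).im) α β H H.neg hτ ha1 ha2 hα hβ hβ0 hHdom hnegdom
      hHint hnegint
  have hsum : Literature.NumberTheory.Transcendental.KZ.of H + Literature.NumberTheory.Transcendental.KZ.of H.neg ∈
      Literature.NumberTheory.Transcendental.KZ.relations :=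
    Literature.NumberTheory.Transcendental.KZ.levelRel_le_relations
      (Literature.NumberTheory.Transcendental.KZ.of_add_of_neg_mem_levelRel H)
  -- `2 • [H] ∈ relations`, hence `[H] ∈ relations` (integer division is a derived rule)
  have htwo : 2 • Literature.NumberTheory.Transcendental.KZ.of H ∈
      Literature.NumberTheory.Transcendental.KZ.relations := by
    have h := Literature.NumberTheory.Transcendental.KZ.relations.add_mem hswap hsum
    convert h using 1
    abel
  have hH : Literature.NumberTheory.Transcendental.KZ.of H ∈
      Literature.NumberTheory.Transcendental.KZ.relations :=
    Summit.KontsevichZagierPeriods.MzvKernelInKZ.Negative.mem_relations_of_nsmul_mem (by norm_num) htwo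
  -- `[r] − [r'] = ([r] − [r'] − [H]) + [H]`
  unfold Literature.NumberTheory.Transcendental.KZ.Equivalent
  have h := Literature.NumberTheory.Transcendental.KZ.relations.add_mem hsplit hH
  convert h using 1
  abel

/-- **The skeleton theorem**: concludes the crux `FibrewiseResidue` BY NAME; `sorry` enters only
through the two named stubs `stub_cayleyDifference`, `stub_swapInvolution`. -/
theorem FibrewiseResidue_of :
    Summit.KontsevichZagierPeriods.KontsevichZagierPeriods.Theses.AttractorUnfolding.FibrewiseResidue :=
  FibrewiseResidue_of_stubs stub_cayleyDifference stub_swapInvolution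

end Summit.KontsevichZagierPeriods.KontsevichZagierPeriods.Cruxes.FibrewiseResidue.PoleSwap
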